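import Mathlib
import HarnessLib
import Summits.Parity.BatemanHorn.Theses.AlmostPrimeZeros
import Summits.Parity.BatemanHorn.Theorems.AlmostPrimeZerosDeficitFromRepulsion

/-!
# `RepulsionFromDeficit` (route AlmostPrimeZeros, item stmt-Parity-14761)

Glue: `SystemMomentDeficit → NonHyperbolicityBound → SystemZeroRepulsion` with constant
`C = C₁ + 2 C₂`.

Pointwise, for `w = a + bi ∈ ℂ`,
`‖w‖⁻² = Re (w²)⁻¹ + 2 (Im w)² / ‖w‖⁴`
(`(a² + b²)⁻¹ = (a² − b²)/(a² + b²)² + 2 b²/(a² + b²)²`; both sides vanish at `w = 0` under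
Lean's `0⁻¹ = 0`).  Summing over the roots `ρ` (with multiplicity) of the almost-prime polynomial
`S_x = ∑_{n ≤ x} X^{s_f(n)} ∈ ℂ[X]` with `w = 1 − ρ` (so `(Im w)² = (Im ρ)²`) and using the tree
identity `∑_ρ (1 − ρ)⁻² = m₁ − v`
(`Summit.Parity.BatemanHorn.Theorems.sum_inv_one_sub_sq_roots_eq`, a real number) gives
`T_f(x) = (m₁ − v) + 2 N_f(x)` exactly, hence `T_f ≤ C₁ + 2 C₂`.

Sources: Pólya–Szegő 1925 (Part V), Obreschkoff 1963, Marden 1966 (sums over the zeros of a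
polynomial); the computation itself is folklore.
-/

noncomputable section

namespace Summit.Parity.BatemanHorn.Theorems

open Polynomial Finset

/-- Pointwise split `‖w‖⁻² = Re (w²)⁻¹ + 2 (Im w)² / ‖w‖⁴` for `w ∈ ℂ`
(with `w = a + bi`: `(a² + b²)⁻¹ = (a² − b²)/(a² + b²)² + 2 b²/(a² + b²)²`; at `w = 0` both sides
are `0`). [folklore] -/
theorem inv_norm_sq_eq_re_inv_sq_add (w : ℂ) :
    (‖w‖ ^ 2)⁻¹ = ((w ^ 2)⁻¹).re + 2 * (w.im ^ 2 / ‖w‖ ^ 4) := by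
  have h4 : ‖w‖ ^ 4 = (Complex.normSq w) ^ 2 := by
    rw [show (4 : ℕ) = 2 * 2 from rfl, pow_mul, Complex.sq_norm]
  have hre : (w ^ 2).re = w.re ^ 2 - w.im ^ 2 := by
    rw [sq, Complex.mul_re]; ring
  rw [Complex.inv_re, map_pow, Complex.sq_norm, h4, hre]
  rcases eq_or_ne w 0 with rfl | hw
  · simp
  have hq : Complex.normSq w ≠ 0 := (map_ne_zero Complex.normSq).mpr hw
  have hq' : Complex.normSq w = w.re ^ 2 + w.im ^ 2 := by
    rw [Complex.normSq_apply]; ring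
  rw [hq'] at hq ⊢
  field_simp
  ring

/-- The pointwise split at `w = 1 − ρ`:
`‖1 − ρ‖⁻² = Re ((1 − ρ)²)⁻¹ + 2 (Im ρ)² / ‖1 − ρ‖⁴`. [folklore] -/
theorem inv_norm_sq_one_sub_eq (ρ : ℂ) :
    (‖(1 : ℂ) - ρ‖ ^ 2)⁻¹ =
      ((((1 : ℂ) - ρ) ^ 2)⁻¹).re + 2 * (ρ.im ^ 2 / ‖(1 : ℂ) - ρ‖ ^ 4) := by
  have him : ((1 : ℂ) - ρ).im ^ 2 = ρ.im ^ 2 := by simp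
  rw [inv_norm_sq_eq_re_inv_sq_add, him]

/-- Summed split over any multiset of complex numbers (roots with multiplicity):
`∑_ρ ‖1 − ρ‖⁻² = Re ∑_ρ ((1 − ρ)²)⁻¹ + 2 ∑_ρ (Im ρ)²/‖1 − ρ‖⁴`. [folklore] -/
theorem multiset_sum_inv_norm_sq_one_sub_eq (s : Multiset ℂ) :
    (s.map fun ρ : ℂ => (‖(1 : ℂ) - ρ‖ ^ 2)⁻¹).sum =
      (s.map fun ρ : ℂ => (((1 : ℂ) - ρ) ^ 2)⁻¹).sum.re +
        2 * (s.map fun ρ : ℂ => ρ.im ^ 2 / ‖(1 : ℂ) - ρ‖ ^ 4).sum := by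
  rw [re_multiset_sum_map, ← Multiset.sum_map_mul_left, ← Multiset.sum_map_add]
  exact congrArg _ (Multiset.map_congr rfl fun ρ _ => inv_norm_sq_one_sub_eq ρ)

/-- **Item stmt-Parity-14761 (`RepulsionFromDeficit`).**
`SystemMomentDeficit → NonHyperbolicityBound → SystemZeroRepulsion`: for every Bateman–Horn
system, `T_f(x) = ∑_ρ ‖1 − ρ‖⁻² = (m₁(x) − v(x)) + 2 ∑_ρ (Im ρ)²/‖1 − ρ‖⁴`
(`multiset_sum_inv_norm_sq_one_sub_eq` and the root-sum identity
`sum_inv_one_sub_sq_roots_eq`), so `T_f(x) ≤ C₁ + 2 C₂` for `x ≥ 2`. -/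
theorem RepulsionFromDeficit_proof :
    Summit.Parity.BatemanHorn.Theses.AlmostPrimeZeros.RepulsionFromDeficit := by
  unfold Summit.Parity.BatemanHorn.Theses.AlmostPrimeZeros.RepulsionFromDeficit
    Summit.Parity.BatemanHorn.Theses.AlmostPrimeZeros.SystemZeroRepulsion
    Summit.Parity.BatemanHorn.Theses.AlmostPrimeZeros.SystemMomentDeficit
    Summit.Parity.BatemanHorn.Theses.AlmostPrimeZeros.NonHyperbolicityBound
  intro hD hN k f hf
  obtain ⟨C₁, hC₁⟩ := hD k f hf
  obtain ⟨C₂, hC₂⟩ := hN k f hf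
  refine ⟨C₁ + 2 * C₂, fun x hx => ?_⟩
  have h₁ := hC₁ x hx
  have h₂ := hC₂ x hx
  have key := congrArg Complex.re (sum_inv_one_sub_sq_roots_eq
    (fun n => ∑ i, (((f i).eval (n : ℤ)).toNat.factorization.sum fun _ v => min v 2)) x)
  rw [Complex.ofReal_re] at key
  rw [multiset_sum_inv_norm_sq_one_sub_eq, key]
  linarith

end Summit.Parity.BatemanHorn.Theorems

end
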